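import Summits.BirchSwinnertonDyer.Rank1Residual.ManinAdditive.CuspidalKummerClass
import Literature.NumberTheory.EllipticCurves.ManinConstantAdditivePrimesProofs
import Literature.NumberTheory.DiophantineGeometry.TateAlgorithmExitMinimalityProofs
import Literature.NumberTheory.EllipticCurves.IsogenyTwoTorsionProofs
import Literature.NumberTheory.EllipticCurves.IsogenyCompProofs
import HarnessLib

/-!
# The L5 dictionary: Kummer-blindness at `2` IS non-minimality at `2` of the `2`-isogenous (Vélu) model

Summit `BirchSwinnertonDyer`, route `ManinLocalTwoThree` (cell bsd-f2-manin), deciding crux C2 `ManinOddAtFour`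
(stmt-BirchSwinnertonDyer-22967).  The cell's blindness predicate
`Summit.BirchSwinnertonDyer.Rank1Residual.ManinAdditive.CuspidalKummer.KummerBlindAtTwo a₂ a₄ e` (`2 ∣ b ∧ 16 ∣ b² − 4c`,
`b = a₂ + e`, `c = a₄ + be`) carries in its docstring the dictionary «equivalently the Vélu model of `W/⟨T⟩` is not minimal
at `2`» (line L5 of MEMO-an §78.11; refuter audit §R145 R-an-67: correct as stated for `ℤ₂`-MINIMAL `W`, with the Vélu model
written in the frame `T = (0,0)`, i.e. `y² = x³ − 2(b + 2e)x² + (b² − 4c)x`; Tate-algorithm scan 1 017 555 / 1 017 555, and the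
minimality hypothesis is load-bearing).  This file PROVES that dictionary in the kernel.

Frame: translating `T = (e, 0)` to the origin, `⟨1, e, 0, 0⟩ • W = ⟨0, A, 0, B, 0⟩`, `A = a₂ + 3e = b + 2e`, `B = 3e² + 2a₂e + a₄`
(`frame_map_eq_smul`; tree `WeierstrassCurve.IsTwoTorsionNF`); its explicit `2`-isogenous curve (Silverman *AEC* III.4.5; tree
`WeierstrassCurve.twoIsogenyCodomain`, `isIsogenous_twoIsogenyCodomain` PROVED) is `⟨0, −2A, 0, A² − 4B, 0⟩`, `A² − 4B = b² − 4c`.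

* §1 `kummerBlindAtTwo_iff_frame` — `KummerBlindAtTwo a₂ a₄ e ↔ 2 ∣ A ∧ 16 ∣ A² − 4B`.
* §2 `frameBlind_or_exit_of_tateExit` — THE FINITE `2`-ADIC CORE (integers, residues mod `64`): if some `u = 1` change
  `(1; r, s, t)` puts `⟨0, −2A, 0, A² − 4B, 0⟩` in Tate's exit position (`4 ∣ a₂'`, `8 ∣ a₃'`, `16 ∣ a₄'`, `64 ∣ a₆'`), then
  EITHER `2 ∣ A ∧ 16 ∣ A² − 4B` OR `A ≡ 1 (mod 4) ∧ 16 ∣ B` — and in the second case `⟨0, A, 0, B, 0⟩` itself exits through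
  `(1; 0, 1, 0)`.  (Parity case analysis; each leaf is linear arithmetic, `omega`.)
* §3 `not_isMinimal_twoIsogenyCodomain_of_frameBlind` / `frameBlind_of_not_isMinimal_twoIsogenyCodomain` /
  `frameBlind_iff_not_isMinimal_twoIsogenyCodomain` — over `ℤ₂` (Mathlib's `WeierstrassCurve.IsMinimal ℤ_[2]`): for
  `B(A² − 4B) ≠ 0` and `⟨0, A, 0, B, 0⟩` minimal at `2`, `2 ∣ A ∧ 16 ∣ A² − 4B ↔ ¬ IsMinimal ℤ_[2] (⟨0, −2A, 0, A² − 4B, 0⟩ ⊗ ℚ₂)`.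
  «⟹» is Tate's Step 11 (tree `TateAlgorithm.not_isMinimal_of_pow_dvd`, `x = 4X, y = 8Y`); «⟸» is the tree's exit lemma
  `WeierstrassCurve.exists_variableChange_pow_dvd_of_not_isMinimal` (*ATAEC* IV.9.4 Step 11 + *AEC* VII.1.3(b)) read through §2.
* §4 the cell's currency: for `W/ℚ` elliptic and globally minimal with `a₁ = a₃ = 0` and an integer reading `(A₂, A₄, E)` of
  `(a₂, a₄, e)`, `e` a root of `x³ + a₂x² + a₄x + a₆`:
  **`kummerBlindAtTwo_iff_not_isMinimal_twoIsogenyCodomain`** —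
  `KummerBlindAtTwo A₂ A₄ E ↔ ¬ IsMinimal ℤ_[2] ((⟨0, A₂+3E, 0, 3E²+2A₂E+A₄, 0⟩.twoIsogenyCodomain) ⊗ ℚ₂)`, together with
  `frame_map_eq_smul`, `isIsogenous_twoIsogenyCodomain_frame` (the model IS a model of the `2`-isogenous curve `W/⟨T⟩`) and
  `isMinimal_frame_two` (the frame is `ℤ₂`-minimal).

HONEST FRAMING: a local dictionary only; C2, Manin's conjecture and BSD are not proved.  No definitions, no named facts, no
sorry; axioms standard.  References: [SilvermanAEC2009] III.4.5, VII.1.3, VIII.8; [SilvermanATAEC1994] IV.9.4 Step 11;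
HOME/MEMO-an.md §56, §78.11; HOME/REFUTER-ref1.md §R145.
-/

set_option autoImplicit false
set_option linter.dupNamespace false

noncomputable section

open scoped Classical
open WeierstrassCurve
open Literature.NumberTheory.DiophantineGeometry.TateAlgorithm (uniformizer irreducible_uniformizer
  not_isMinimal_of_pow_dvd mem_maximalIdeal_pow_iff_dvd mem_maximalIdeal_pow_iff_dvd_of_irreducible)
open Summit.BirchSwinnertonDyer.Rank1Residual.ManinAdditive.CuspidalKummer

namespace Summit.BirchSwinnertonDyer.BirchSwinnertonDyer.Theorems.ManinLocalTwoThree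

/-! ## §1 The frame `T = (0, 0)` -/

/-- **Kummer-blindness in the frame `T = (0,0)`:** with `A = a₂ + 3e`, `B = 3e² + 2a₂e + a₄` (the coefficients of
`⟨1, e, 0, 0⟩ • [0, a₂, 0, a₄, a₆]`), `KummerBlindAtTwo a₂ a₄ e ↔ 2 ∣ A ∧ 16 ∣ A² − 4B` (`A = b + 2e`, `A² − 4B = b² − 4c`).
[folklore] -/
theorem kummerBlindAtTwo_iff_frame (a₂ a₄ e : ℤ) :
    KummerBlindAtTwo a₂ a₄ e ↔
      (2 : ℤ) ∣ a₂ + 3 * e ∧ (16 : ℤ) ∣ (a₂ + 3 * e) ^ 2 - 4 * (3 * e ^ 2 + 2 * a₂ * e + a₄) := by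
  unfold KummerBlindAtTwo
  rw [even_iff_two_dvd]
  have h1 : (a₂ + 3 * e) ^ 2 - 4 * (3 * e ^ 2 + 2 * a₂ * e + a₄) = (a₂ + e) ^ 2 - 4 * (a₄ + (a₂ + e) * e) := by ring
  rw [h1]
  constructor <;> rintro ⟨h2, h16⟩ <;> exact ⟨by omega, h16⟩

/-! ## §2 The finite `2`-adic core -/

/-- **The finite `2`-adic core of the L5 dictionary.**  If integers `r, s, t` put the `u = 1` translate of
`⟨0, −2A, 0, A² − 4B, 0⟩` in Tate's exit position — `4 ∣ a₂' = −2A + 3r − s²`, `8 ∣ a₃' = 2t`,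
`16 ∣ a₄' = A² − 4B − 4rA + 3r² − 2st`, `64 ∣ a₆' = r(A² − 4B) − 2Ar² + r³ − t²` — then either `2 ∣ A ∧ 16 ∣ A² − 4B`
(the blind case) or `A ≡ 1 (mod 4) ∧ 16 ∣ B` (the case in which `⟨0, A, 0, B, 0⟩` is itself non-minimal).  Only residues
mod `64` matter; parity case analysis (`A, s`, then `r mod 4`, then `r = A + 2u₁`), every leaf linear (`omega`).
[cite: SilvermanATAEC1994, IV.9.4 Step 11] -/
theorem frameBlind_or_exit_of_tateExit (A B r s t : ℤ)
    (h2 : (4 : ℤ) ∣ -(2 * A) + 3 * r - s ^ 2)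
    (h3 : (8 : ℤ) ∣ 2 * t)
    (h4 : (16 : ℤ) ∣ A ^ 2 - 4 * B - 4 * r * A + 3 * r ^ 2 - 2 * s * t)
    (h6 : (64 : ℤ) ∣ r * (A ^ 2 - 4 * B) - 2 * A * r ^ 2 + r ^ 3 - t ^ 2) :
    (2 ∣ A ∧ 16 ∣ A ^ 2 - 4 * B) ∨ (4 ∣ A - 1 ∧ 16 ∣ B) := by
  obtain ⟨t₁, rfl⟩ : ∃ t₁, t = 4 * t₁ := ⟨t / 4, by omega⟩
  obtain ⟨A₁, rfl | rfl⟩ := Int.even_or_odd' A <;> obtain ⟨s₁, rfl | rfl⟩ := Int.even_or_odd' s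
  · -- `A` even, `s` even: `r ≡ 0 (mod 4)`, and `a₄'` gives `16 ∣ A² − 4B`
    obtain ⟨r₁, rfl⟩ : ∃ r₁, r = 4 * r₁ := ⟨r / 4, by ring_nf at h2; omega⟩
    left
    ring_nf at h4 ⊢
    omega
  · -- `A` even, `s` odd: `r ≡ 3 (mod 4)`, and `a₆'` is `≡ 3 (mod 4)`
    exfalso
    obtain ⟨r₁, rfl⟩ : ∃ r₁, r = 4 * r₁ + 3 := ⟨(r - 3) / 4, by ring_nf at h2; omega⟩
    ring_nf at h6
    omega
  · -- `A` odd, `s` even: `r ≡ 2 (mod 4)`, and `a₆'` is `≡ 4r₁ + 2 (mod 8)`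
    exfalso
    obtain ⟨r₁, rfl⟩ : ∃ r₁, r = 4 * r₁ + 2 := ⟨(r - 2) / 4, by ring_nf at h2; omega⟩
    ring_nf at h6
    omega
  · -- `A` odd, `s` odd: `r` is odd; write `r = A + 2u₁`
    obtain ⟨u₁, rfl⟩ : ∃ u₁, r = 2 * A₁ + 1 + 2 * u₁ :=
      ⟨(r - (2 * A₁ + 1)) / 2, by ring_nf at h2; omega⟩
    obtain ⟨u₂, rfl | rfl⟩ := Int.even_or_odd' u₁
    · -- `u₁` even: `A ≡ 1 (mod 4)` and `16 ∣ B`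
      right
      obtain ⟨A₂, rfl⟩ : ∃ A₂, A₁ = 2 * A₂ := ⟨A₁ / 2, by ring_nf at h2; omega⟩
      obtain ⟨B₁, rfl⟩ : ∃ B₁, B = 2 * B₁ := ⟨B / 2, by ring_nf at h4; omega⟩
      obtain ⟨B₂, rfl⟩ : ∃ B₂, B₁ = 2 * B₂ := ⟨B₁ / 2, by ring_nf at h6; omega⟩
      obtain ⟨u₃, rfl | rfl⟩ := Int.even_or_odd' u₂ <;> obtain ⟨t₂, rfl | rfl⟩ := Int.even_or_odd' t₁ <;>
        · ring_nf at h4 h6 ⊢; omega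
    · -- `u₁` odd: `a₆'/4` is odd
      exfalso
      obtain ⟨B₁, rfl⟩ : ∃ B₁, B = 2 * B₁ := ⟨B / 2, by ring_nf at h4; omega⟩
      ring_nf at h6
      omega

/-! ## §3 The dictionary over `ℤ₂` -/

section Local

/-- `2ⁿ ∣ x ↔ ϖⁿ ∣ x` in `ℤ₂` for the tree's chosen uniformiser `ϖ`. [folklore] -/
private theorem two_pow_dvd_iff_uniformizer_pow_dvd (x : ℤ_[2]) (n : ℕ) :
    (2 : ℤ_[2]) ^ n ∣ x ↔ uniformizer ℤ_[2] ^ n ∣ x := by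
  have h2 : Irreducible (2 : ℤ_[2]) := by simpa using PadicInt.irreducible_p (p := 2)
  rw [← mem_maximalIdeal_pow_iff_dvd_of_irreducible h2, mem_maximalIdeal_pow_iff_dvd]

/-- `2ⁿ ∣ m` in `ℤ₂` iff `2ⁿ ∣ m` in `ℤ`, for an integer `m`. [folklore] -/
private theorem two_pow_dvd_intCast_iff (n : ℕ) (m : ℤ) :
    (2 : ℤ_[2]) ^ n ∣ (m : ℤ_[2]) ↔ (2 : ℤ) ^ n ∣ m := by
  simpa using PadicInt.pow_p_dvd_int_iff (p := 2) n m

/-- Every `2`-adic integer is an integer modulo `2⁶`. [folklore] -/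
private theorem exists_int_two_pow_six_dvd_sub (x : ℤ_[2]) : ∃ m : ℤ, (2 : ℤ_[2]) ^ 6 ∣ x - m := by
  refine ⟨(x.appr 6 : ℕ), ?_⟩
  have h := PadicInt.appr_spec 6 x
  rw [Ideal.mem_span_singleton] at h
  simpa using h

/-- From `2⁶ ∣ x − y` and `2ᵏ ∣ x` (`k ≤ 6`) to `2ᵏ ∣ y`. [folklore] -/
private theorem two_pow_dvd_of_dvd_sub {k : ℕ} (hk : k ≤ 6) {x y : ℤ_[2]} (hxy : (2 : ℤ_[2]) ^ 6 ∣ x - y)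
    (hx : (2 : ℤ_[2]) ^ k ∣ x) : (2 : ℤ_[2]) ^ k ∣ y := by
  simpa using dvd_sub hx (dvd_trans (pow_dvd_pow 2 hk) hxy)

/-- The two `ℚ₂`-models of an integer equation agree: `(V ⊗ ℤ₂) ⊗ ℚ₂ = V ⊗ ℚ₂`. [folklore] -/
private theorem baseChange_map_int_padicInt (V : WeierstrassCurve ℤ) :
    (V.map (Int.castRingHom ℤ_[2])).baseChange ℚ_[2] = V.map (Int.castRingHom ℚ_[2]) := by
  rw [baseChange, map_map,
    show (algebraMap ℤ_[2] ℚ_[2]).comp (Int.castRingHom ℤ_[2]) = Int.castRingHom ℚ_[2] from RingHom.ext_int _ _]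

/-- **L5, «⟹» (Tate Step 11):** `2 ∣ A` and `16 ∣ A² − 4B` make `⟨0, −2A, 0, A² − 4B, 0⟩` non-minimal at `2`
(`x = 4X`, `y = 8Y` is `2`-integral with discriminant `2⁻¹² Δ`).  Hypotheses `B ≠ 0`, `A² − 4B ≠ 0`: the curve is
nonsingular (`Δ = 2⁸·16B·(A² − 4B)²`). [cite: SilvermanATAEC1994, IV.9.4 Step 11] -/
theorem not_isMinimal_twoIsogenyCodomain_of_frameBlind (A B : ℤ) (hB : B ≠ 0) (hAB : A ^ 2 - 4 * B ≠ 0)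
    (h2 : (2 : ℤ) ∣ A) (h16 : (16 : ℤ) ∣ A ^ 2 - 4 * B) :
    ¬ ((⟨0, A, 0, B, 0⟩ : WeierstrassCurve ℤ).twoIsogenyCodomain.map (Int.castRingHom ℚ_[2])).IsMinimal ℤ_[2] := by
  set N' : WeierstrassCurve ℤ_[2] := ⟨0, ((-2 * A : ℤ) : ℤ_[2]), 0, ((A ^ 2 - 4 * B : ℤ) : ℤ_[2]), 0⟩ with hN'
  have hmodel : ((⟨0, A, 0, B, 0⟩ : WeierstrassCurve ℤ).twoIsogenyCodomain.map (Int.castRingHom ℚ_[2])) =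
      N'.baseChange ℚ_[2] := by
    ext <;> simp only [map_a₁, map_a₂, map_a₃, map_a₄, map_a₆, twoIsogenyCodomain_a₁, twoIsogenyCodomain_a₂,
      twoIsogenyCodomain_a₃, twoIsogenyCodomain_a₄, twoIsogenyCodomain_a₆, hN', baseChange, eq_intCast, map_intCast, map_zero]
  rw [hmodel]
  have hΔ : N'.Δ ≠ 0 := by
    have hcast : N'.Δ = ((16 * (A ^ 2 - 4 * B) ^ 2 * ((-2 * A) ^ 2 - 4 * (A ^ 2 - 4 * B)) : ℤ) : ℤ_[2]) := by
      rw [Δ_of_isTwoTorsionNF]; push_cast [hN']; ring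
    rw [hcast, Int.cast_ne_zero]
    have : (-2 * A) ^ 2 - 4 * (A ^ 2 - 4 * B) = 16 * B := by ring
    rw [this]
    exact mul_ne_zero (mul_ne_zero (by norm_num) (pow_ne_zero 2 hAB)) (mul_ne_zero (by norm_num) hB)
  refine not_isMinimal_of_pow_dvd ℚ_[2] hΔ 1 ?_ ?_ ?_ ?_ ?_
  · simp [hN']
  · rw [one_smul, ← two_pow_dvd_iff_uniformizer_pow_dvd]
    have h4 : (2 : ℤ) ^ 2 ∣ -2 * A := by
      obtain ⟨k, rfl⟩ := h2; exact ⟨-k, by ring⟩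
    have := (two_pow_dvd_intCast_iff 2 _).mpr h4
    simpa [hN'] using this
  · simp [hN']
  · rw [one_smul, ← two_pow_dvd_iff_uniformizer_pow_dvd]
    have h16' : (2 : ℤ) ^ 4 ∣ A ^ 2 - 4 * B := by norm_num; exact h16
    have := (two_pow_dvd_intCast_iff 4 _).mpr h16'
    simpa [hN'] using this
  · simp [hN']

/-- **L5, «⟸» (Tate's exit + the finite core):** if `⟨0, A, 0, B, 0⟩` (`B(A² − 4B) ≠ 0`) is minimal at `2` and its
`2`-isogenous model `⟨0, −2A, 0, A² − 4B, 0⟩` is NOT, then `2 ∣ A` and `16 ∣ A² − 4B`.  The non-minimal model admits a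
`u = 1` change over `ℤ₂` into Tate's exit position (tree `exists_variableChange_pow_dvd_of_not_isMinimal`); reducing `r, s, t`
mod `2⁶` to integers, §2 leaves the blind alternative or `A ≡ 1 (mod 4) ∧ 16 ∣ B`, and the latter would put
`⟨0, A, 0, B, 0⟩` itself in exit position through `(1; 0, 1, 0)` (`a₁' = 2`, `a₂' = A − 1`, `a₄' = B`), contradicting its
minimality (Step 11). [cite: SilvermanATAEC1994, IV.9.4 Step 11] [cite: SilvermanAEC2009, VII.1 Prop. 1.3(b)] -/
theorem frameBlind_of_not_isMinimal_twoIsogenyCodomain (A B : ℤ) (hB : B ≠ 0) (hAB : A ^ 2 - 4 * B ≠ 0)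
    (hmin : ((⟨0, A, 0, B, 0⟩ : WeierstrassCurve ℤ).map (Int.castRingHom ℚ_[2])).IsMinimal ℤ_[2])
    (hV : ¬ ((⟨0, A, 0, B, 0⟩ : WeierstrassCurve ℤ).twoIsogenyCodomain.map (Int.castRingHom ℚ_[2])).IsMinimal ℤ_[2]) :
    (2 : ℤ) ∣ A ∧ (16 : ℤ) ∣ A ^ 2 - 4 * B := by
  -- the two `ℤ₂`-models
  set N : WeierstrassCurve ℤ_[2] := ⟨0, (A : ℤ_[2]), 0, B, 0⟩ with hN
  set N' : WeierstrassCurve ℤ_[2] := ⟨0, ((-2 * A : ℤ) : ℤ_[2]), 0, ((A ^ 2 - 4 * B : ℤ) : ℤ_[2]), 0⟩ with hN'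
  have hmodel : ((⟨0, A, 0, B, 0⟩ : WeierstrassCurve ℤ).map (Int.castRingHom ℚ_[2])) = N.baseChange ℚ_[2] := by
    ext <;> simp only [map_a₁, map_a₂, map_a₃, map_a₄, map_a₆, hN, baseChange, eq_intCast, map_intCast, map_zero]
  have hmodel' : ((⟨0, A, 0, B, 0⟩ : WeierstrassCurve ℤ).twoIsogenyCodomain.map (Int.castRingHom ℚ_[2])) =
      N'.baseChange ℚ_[2] := by
    ext <;> simp only [map_a₁, map_a₂, map_a₃, map_a₄, map_a₆, twoIsogenyCodomain_a₁, twoIsogenyCodomain_a₂,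
      twoIsogenyCodomain_a₃, twoIsogenyCodomain_a₄, twoIsogenyCodomain_a₆, hN', baseChange, eq_intCast, map_intCast, map_zero]
  rw [hmodel] at hmin
  rw [hmodel'] at hV
  -- Tate's exit position for `N'`
  obtain ⟨T, hTu, -, hT2, hT3, hT4, hT6⟩ := exists_variableChange_pow_dvd_of_not_isMinimal N' hV
  rw [← two_pow_dvd_iff_uniformizer_pow_dvd] at hT2 hT3 hT4 hT6
  have e2 : (T • N').a₂ = -(2 * (A : ℤ_[2])) + 3 * T.r - T.s ^ 2 := by
    simp [variableChange_a₂, hTu, hN']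
  have e3 : (T • N').a₃ = 2 * T.t := by
    simp [variableChange_a₃, hTu, hN']
  have e4 : (T • N').a₄ = (A : ℤ_[2]) ^ 2 - 4 * B - 4 * T.r * A + 3 * T.r ^ 2 - 2 * T.s * T.t := by
    simp [variableChange_a₄, hTu, hN']; ring
  have e6 : (T • N').a₆ = T.r * ((A : ℤ_[2]) ^ 2 - 4 * B) - 2 * A * T.r ^ 2 + T.r ^ 3 - T.t ^ 2 := by
    simp [variableChange_a₆, hTu, hN']; ring
  rw [e2] at hT2; rw [e3] at hT3; rw [e4] at hT4; rw [e6] at hT6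
  -- integer representatives of `r, s, t` modulo `2⁶`
  obtain ⟨ρ, hρ⟩ := exists_int_two_pow_six_dvd_sub T.r
  obtain ⟨σ, hσ⟩ := exists_int_two_pow_six_dvd_sub T.s
  obtain ⟨τ, hτ⟩ := exists_int_two_pow_six_dvd_sub T.t
  set ψ := Ideal.Quotient.mk (Ideal.span {(2 : ℤ_[2]) ^ 6}) with hψ
  have hψr : ψ T.r = ψ (ρ : ℤ_[2]) := Ideal.Quotient.eq.mpr (Ideal.mem_span_singleton.mpr hρ)
  have hψs : ψ T.s = ψ (σ : ℤ_[2]) := Ideal.Quotient.eq.mpr (Ideal.mem_span_singleton.mpr hσ)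
  have hψt : ψ T.t = ψ (τ : ℤ_[2]) := Ideal.Quotient.eq.mpr (Ideal.mem_span_singleton.mpr hτ)
  have key : ∀ {x y : ℤ_[2]}, ψ x = ψ y → (2 : ℤ_[2]) ^ 6 ∣ x - y := fun h =>
    Ideal.mem_span_singleton.mp (Ideal.Quotient.eq.mp h)
  have H2 : (4 : ℤ) ∣ -(2 * A) + 3 * ρ - σ ^ 2 := by
    have h : (2 : ℤ_[2]) ^ 2 ∣ ((-(2 * A) + 3 * ρ - σ ^ 2 : ℤ) : ℤ_[2]) := by
      refine two_pow_dvd_of_dvd_sub (by norm_num) (key ?_) hT2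
      push_cast
      simp only [map_add, map_sub, map_neg, map_mul, map_pow, map_ofNat, hψr, hψs]
    have := (two_pow_dvd_intCast_iff 2 _).mp h
    norm_num at this
    exact this
  have H3 : (8 : ℤ) ∣ 2 * τ := by
    have h : (2 : ℤ_[2]) ^ 3 ∣ ((2 * τ : ℤ) : ℤ_[2]) := by
      refine two_pow_dvd_of_dvd_sub (by norm_num) (key ?_) hT3
      push_cast
      simp only [map_mul, map_ofNat, hψt]
    have := (two_pow_dvd_intCast_iff 3 _).mp h
    norm_num at this
    exact this
  have H4 : (16 : ℤ) ∣ A ^ 2 - 4 * B - 4 * ρ * A + 3 * ρ ^ 2 - 2 * σ * τ := by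
    have h : (2 : ℤ_[2]) ^ 4 ∣ ((A ^ 2 - 4 * B - 4 * ρ * A + 3 * ρ ^ 2 - 2 * σ * τ : ℤ) : ℤ_[2]) := by
      refine two_pow_dvd_of_dvd_sub (by norm_num) (key ?_) hT4
      push_cast
      simp only [map_add, map_sub, map_mul, map_pow, map_ofNat, hψr, hψs, hψt]
    have := (two_pow_dvd_intCast_iff 4 _).mp h
    norm_num at this
    exact this
  have H6 : (64 : ℤ) ∣ ρ * (A ^ 2 - 4 * B) - 2 * A * ρ ^ 2 + ρ ^ 3 - τ ^ 2 := by
    have h : (2 : ℤ_[2]) ^ 6 ∣ ((ρ * (A ^ 2 - 4 * B) - 2 * A * ρ ^ 2 + ρ ^ 3 - τ ^ 2 : ℤ) : ℤ_[2]) := by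
      refine two_pow_dvd_of_dvd_sub le_rfl (key ?_) hT6
      push_cast
      simp only [map_add, map_sub, map_mul, map_pow, map_ofNat, hψr, hψt]
    have := (two_pow_dvd_intCast_iff 6 _).mp h
    norm_num at this
    exact this
  -- the finite core
  rcases frameBlind_or_exit_of_tateExit A B ρ σ τ H2 H3 H4 H6 with hblind | ⟨hA1, hB16⟩
  · exact hblind
  -- the exit alternative contradicts the minimality of `N` (Step 11 through `(1; 0, 1, 0)`)
  exfalso
  have hΔ : N.Δ ≠ 0 := by
    have hcast : N.Δ = ((16 * B ^ 2 * (A ^ 2 - 4 * B) : ℤ) : ℤ_[2]) := by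
      rw [Δ_of_isTwoTorsionNF]; push_cast [hN]; ring
    rw [hcast, Int.cast_ne_zero]
    exact mul_ne_zero (mul_ne_zero (by norm_num) (pow_ne_zero 2 hB)) hAB
  refine not_isMinimal_of_pow_dvd ℚ_[2] hΔ ⟨1, 0, 1, 0⟩ ?_ ?_ ?_ ?_ ?_ hmin
  · rw [← pow_one (uniformizer ℤ_[2]), ← two_pow_dvd_iff_uniformizer_pow_dvd]
    simp [variableChange_a₁, hN]
  · rw [← two_pow_dvd_iff_uniformizer_pow_dvd]
    have h : (2 : ℤ_[2]) ^ 2 ∣ ((A - 1 : ℤ) : ℤ_[2]) := (two_pow_dvd_intCast_iff 2 _).mpr (by norm_num; exact hA1)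
    have e : ((⟨1, 0, 1, 0⟩ : VariableChange ℤ_[2]) • N).a₂ = ((A - 1 : ℤ) : ℤ_[2]) := by
      simp [variableChange_a₂, hN]
    rwa [e]
  · simp [variableChange_a₃, hN]
  · rw [← two_pow_dvd_iff_uniformizer_pow_dvd]
    have h : (2 : ℤ_[2]) ^ 4 ∣ ((B : ℤ) : ℤ_[2]) := (two_pow_dvd_intCast_iff 4 _).mpr (by norm_num; exact hB16)
    have e : ((⟨1, 0, 1, 0⟩ : VariableChange ℤ_[2]) • N).a₄ = (B : ℤ_[2]) := by
      simp [variableChange_a₄, hN]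
    rwa [e]
  · simp [variableChange_a₆, hN]

/-- **The L5 dictionary over `ℤ₂`.**  For integers `A, B` with `B(A² − 4B) ≠ 0` and `⟨0, A, 0, B, 0⟩` minimal at `2`:
`2 ∣ A ∧ 16 ∣ A² − 4B ↔` the `2`-isogenous model `⟨0, −2A, 0, A² − 4B, 0⟩` (tree `twoIsogenyCodomain`, Silverman III.4.5)
is not minimal at `2`. [cite: SilvermanAEC2009, III.4 Example 4.5 and VII.1 Prop. 1.3] -/
theorem frameBlind_iff_not_isMinimal_twoIsogenyCodomain (A B : ℤ) (hB : B ≠ 0) (hAB : A ^ 2 - 4 * B ≠ 0)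
    (hmin : ((⟨0, A, 0, B, 0⟩ : WeierstrassCurve ℤ).map (Int.castRingHom ℚ_[2])).IsMinimal ℤ_[2]) :
    ((2 : ℤ) ∣ A ∧ (16 : ℤ) ∣ A ^ 2 - 4 * B) ↔
      ¬ ((⟨0, A, 0, B, 0⟩ : WeierstrassCurve ℤ).twoIsogenyCodomain.map (Int.castRingHom ℚ_[2])).IsMinimal ℤ_[2] :=
  ⟨fun h => not_isMinimal_twoIsogenyCodomain_of_frameBlind A B hB hAB h.1 h.2,
    fun h => frameBlind_of_not_isMinimal_twoIsogenyCodomain A B hB hAB hmin h⟩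

end Local

/-! ## §4 The cell's currency: a globally minimal `[0, a₂, 0, a₄, a₆]` with a rational `2`-torsion point -/

section Global

variable (W : WeierstrassCurve ℚ)

/-- **The frame.**  For `W = [0, a₂, 0, a₄, a₆]` and a root `e` of `x³ + a₂x² + a₄x + a₆` with integer readings
`(A₂, A₄, E)`: `⟨0, A₂ + 3E, 0, 3E² + 2A₂E + A₄, 0⟩ ⊗ ℚ = ⟨1, e, 0, 0⟩ • W` (translate `T = (e,0)` to the origin).
[cite: SilvermanAEC2009, III.1 (change of variables formulas)] -/
theorem frame_map_eq_smul (ha₁ : W.a₁ = 0) (ha₃ : W.a₃ = 0) {e : ℚ}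
    (he : e ^ 3 + W.a₂ * e ^ 2 + W.a₄ * e + W.a₆ = 0) (A₂ A₄ E : ℤ) (hA₂ : (A₂ : ℚ) = W.a₂)
    (hA₄ : (A₄ : ℚ) = W.a₄) (hE : (E : ℚ) = e) :
    (⟨0, A₂ + 3 * E, 0, 3 * E ^ 2 + 2 * A₂ * E + A₄, 0⟩ : WeierstrassCurve ℤ).map (Int.castRingHom ℚ) =
      (⟨1, e, 0, 0⟩ : VariableChange ℚ) • W := by
  ext
  · simp [variableChange_a₁, ha₁]
  · simp [variableChange_a₂, ha₁, ← hA₂, ← hE]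
  · simp [variableChange_a₃, ha₁, ha₃]
  · simp [variableChange_a₄, ha₁, ha₃, ← hA₂, ← hA₄, ← hE]; ring
  · simp [variableChange_a₆, ha₁, ha₃]
    rw [← hE, ← hA₂, ← hA₄] at he ⊢
    linear_combination (-1 : ℚ) * he

/-- **The Vélu model is a model of the `2`-isogenous curve `W/⟨T⟩`:** `W` is isogenous over `ℚ` to
`⟨0, A₂ + 3E, 0, 3E² + 2A₂E + A₄, 0⟩.twoIsogenyCodomain ⊗ ℚ = ⟨0, −2(b + 2e), 0, b² − 4c, 0⟩` (`W ≅ ⟨1,e,0,0⟩ • W`, then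
Silverman's explicit `2`-isogeny, tree `isIsogenous_twoIsogenyCodomain`). [cite: SilvermanAEC2009, III.4 Example 4.5] -/
theorem isIsogenous_twoIsogenyCodomain_frame [W.IsElliptic] (ha₁ : W.a₁ = 0) (ha₃ : W.a₃ = 0) {e : ℚ}
    (he : e ^ 3 + W.a₂ * e ^ 2 + W.a₄ * e + W.a₆ = 0) (A₂ A₄ E : ℤ) (hA₂ : (A₂ : ℚ) = W.a₂)
    (hA₄ : (A₄ : ℚ) = W.a₄) (hE : (E : ℚ) = e) :
    IsIsogenous W
      ((⟨0, A₂ + 3 * E, 0, 3 * E ^ 2 + 2 * A₂ * E + A₄, 0⟩ : WeierstrassCurve ℤ).twoIsogenyCodomain.map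
        (Int.castRingHom ℚ)) := by
  have hF := frame_map_eq_smul W ha₁ ha₃ he A₂ A₄ E hA₂ hA₄ hE
  set F : WeierstrassCurve ℚ := (⟨1, e, 0, 0⟩ : VariableChange ℚ) • W with hFdef
  haveI : F.IsTwoTorsionNF := by rw [← hF]; infer_instance
  have h1 : IsIsogenous W F := isIsogenous_smul W _
  have h2 : IsIsogenous F F.twoIsogenyCodomain := isIsogenous_twoIsogenyCodomain F
  have hcod : F.twoIsogenyCodomain =
      ((⟨0, A₂ + 3 * E, 0, 3 * E ^ 2 + 2 * A₂ * E + A₄, 0⟩ : WeierstrassCurve ℤ).twoIsogenyCodomain.map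
        (Int.castRingHom ℚ)) := by
    rw [← twoIsogenyCodomain_map, hF]
  rw [← hcod]
  exact IsIsogenous.trans' h1 h2

/-- **The frame is `ℤ₂`-minimal:** `⟨0, A₂ + 3E, 0, 3E² + 2A₂E + A₄, 0⟩ ⊗ ℚ₂ = (1; E, 0, 0) • (W ⊗ ℚ₂)` is an
`ℤ₂`-change of variables of the `ℤ₂`-minimal `W ⊗ ℚ₂` (tree `isMinimal_map_padic_of_isGloballyMinimal`,
`IsMinimal.smul_baseChange`). [cite: SilvermanAEC2009, VII.1 Prop. 1.3(b) and VIII.8] -/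
theorem isMinimal_frame_two [W.IsGloballyMinimal] (ha₁ : W.a₁ = 0) (ha₃ : W.a₃ = 0) {e : ℚ}
    (he : e ^ 3 + W.a₂ * e ^ 2 + W.a₄ * e + W.a₆ = 0) (A₂ A₄ E : ℤ) (hA₂ : (A₂ : ℚ) = W.a₂)
    (hA₄ : (A₄ : ℚ) = W.a₄) (hE : (E : ℚ) = e) :
    ((⟨0, A₂ + 3 * E, 0, 3 * E ^ 2 + 2 * A₂ * E + A₄, 0⟩ : WeierstrassCurve ℤ).map
      (Int.castRingHom ℚ_[2])).IsMinimal ℤ_[2] := by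
  haveI hW2 := isMinimal_map_padic_of_isGloballyMinimal W 2
  have hF := frame_map_eq_smul W ha₁ ha₃ he A₂ A₄ E hA₂ hA₄ hE
  set D : VariableChange ℤ_[2] := ⟨1, (E : ℤ_[2]), 0, 0⟩ with hD
  have key := IsMinimal.smul_baseChange (R := ℤ_[2]) (W.map (algebraMap ℚ ℚ_[2])) D
  have hDC : D.baseChange ℚ_[2] = (⟨1, e, 0, 0⟩ : VariableChange ℚ).map (algebraMap ℚ ℚ_[2]) := by
    rw [← hE]
    ext <;> simp [hD, VariableChange.baseChange, VariableChange.map]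
  have hmodel : D.baseChange ℚ_[2] • W.map (algebraMap ℚ ℚ_[2]) =
      (⟨0, A₂ + 3 * E, 0, 3 * E ^ 2 + 2 * A₂ * E + A₄, 0⟩ : WeierstrassCurve ℤ).map (Int.castRingHom ℚ_[2]) := by
    rw [hDC, map_variableChange, ← hF, map_map,
      show (algebraMap ℚ ℚ_[2]).comp (Int.castRingHom ℚ) = Int.castRingHom ℚ_[2] from RingHom.ext_int _ _]
  rwa [hmodel] at key

/-- **THE L5 DICTIONARY (MEMO-an §78.11 line L5; ref1 §R145 R-an-67) AS A THEOREM.**  Let `W/ℚ` be elliptic and globally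
minimal with `a₁ = a₃ = 0`, `e` a root of `x³ + a₂x² + a₄x + a₆` (so `T = (e, 0)` is a rational `2`-torsion point), and
`(A₂, A₄, E)` an integer reading of `(a₂, a₄, e)`.  Then `T` is KUMMER-BLIND at `2` (`KummerBlindAtTwo A₂ A₄ E`:
`2 ∣ b ∧ 16 ∣ b² − 4c`, `b = a₂ + e`, `c = a₄ + be`) **iff** the Vélu/Silverman model
`⟨0, A₂+3E, 0, 3E²+2A₂E+A₄, 0⟩.twoIsogenyCodomain = ⟨0, −2(b + 2e), 0, b² − 4c, 0⟩` of the `2`-isogenous curve `W/⟨T⟩`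
(`isIsogenous_twoIsogenyCodomain_frame`) is NOT minimal at `2`.  The `ℤ₂`-minimality of `W` is used (and needed) for «⟸».
[cite: SilvermanAEC2009, III.4 Example 4.5, VII.1 Prop. 1.3 and VIII.8] [cite: SilvermanATAEC1994, IV.9.4 Step 11] -/
theorem kummerBlindAtTwo_iff_not_isMinimal_twoIsogenyCodomain [W.IsElliptic] [W.IsGloballyMinimal] (ha₁ : W.a₁ = 0) (ha₃ : W.a₃ = 0) {e : ℚ}
    (he : e ^ 3 + W.a₂ * e ^ 2 + W.a₄ * e + W.a₆ = 0) (A₂ A₄ E : ℤ) (hA₂ : (A₂ : ℚ) = W.a₂)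
    (hA₄ : (A₄ : ℚ) = W.a₄) (hE : (E : ℚ) = e) :
    KummerBlindAtTwo A₂ A₄ E ↔
      ¬ ((⟨0, A₂ + 3 * E, 0, 3 * E ^ 2 + 2 * A₂ * E + A₄, 0⟩ : WeierstrassCurve ℤ).twoIsogenyCodomain.map
          (Int.castRingHom ℚ_[2])).IsMinimal ℤ_[2] := by
  have hF := frame_map_eq_smul W ha₁ ha₃ he A₂ A₄ E hA₂ hA₄ hE
  -- nonsingularity of the frame: `Δ(⟨1,e,0,0⟩ • W) = Δ(W) ≠ 0` and `Δ = 16 B² (A² − 4B)`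
  have h1 : ((⟨0, A₂ + 3 * E, 0, 3 * E ^ 2 + 2 * A₂ * E + A₄, 0⟩ : WeierstrassCurve ℤ).map (Int.castRingHom ℚ)).Δ ≠ 0 := by
    rw [hF, variableChange_Δ]
    exact mul_ne_zero (by simp) W.isUnit_Δ.ne_zero
  rw [map_Δ] at h1
  have hΔ : (⟨0, A₂ + 3 * E, 0, 3 * E ^ 2 + 2 * A₂ * E + A₄, 0⟩ : WeierstrassCurve ℤ).Δ ≠ 0 := fun h => h1 (by rw [h, map_zero])
  simp only [Δ_of_isTwoTorsionNF] at hΔ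
  have hB : (3 * E ^ 2 + 2 * A₂ * E + A₄ : ℤ) ≠ 0 := by
    intro h; apply hΔ; rw [h]; ring
  have hAB : ((A₂ + 3 * E) ^ 2 - 4 * (3 * E ^ 2 + 2 * A₂ * E + A₄) : ℤ) ≠ 0 := by
    intro h; apply hΔ; rw [h]; ring
  rw [kummerBlindAtTwo_iff_frame]
  exact frameBlind_iff_not_isMinimal_twoIsogenyCodomain _ _ hB hAB (isMinimal_frame_two W ha₁ ha₃ he A₂ A₄ E hA₂ hA₄ hE)

end Global

end Summit.BirchSwinnertonDyer.BirchSwinnertonDyer.Theorems.ManinLocalTwoThree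

end
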